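import Summits.NavierStokesRegularity.NavierStokesRegularity.Theorems.TypeICertificateLadderTargetStrainCubeLambSplitPointwise
import HarnessLib

/-!
# Crux `Target` = `TypeICertificateLadder.NoTypeIBlowup` (stmt-NavierStokesRegularity-1217), line
# `depletion-ladder`: THE LAMB / STRAIN-CUBE SPLIT at a fixed regularised weight

`--supports stmt-NavierStokesRegularity-1217` (helper; second of three files, after `…StrainCubeLambSplitPointwise`).
Author: STA lineage `ns-sta-19551-p1` (g11).

`lamb_split_weight_le`: for a `C^∞` divergence-free `v` with `|v| ≤ M`, `‖Dv‖ ≤ B`, `D¹v, D²v ∈ L²`, its strain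
`s`, an admissible smooth weight `0 ≤ N ≤ |S|` (the regularisations `√(q+ε²) − ε` of the landed interpolation) and
`0 ≤ λ ≤ 1`:

  `(1−λ)|∫⟪curl v, Dv curl v⟫| + λ(2√6/9)∫|S|²N ≤
     M( ‖curl curl v‖₂ √((1−λ)²‖curl v‖₂² + (λ√6/9)²‖S‖₂²) + λ(2√6/9)√(2/3) ‖S‖₂ ‖∇S‖₂ )`

— the pointwise split bound `lamb_split_pointwise` integrated (Lamb pairing `…DepletionLambPairing` for the
first copy of `J`, the weighted integration by parts `integral_sumSq_mul_weight_eq` for the second), then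
Cauchy–Schwarz twice and `N² ≤ q`. The `ε → 0` limit, the optimisation in `λ` and the rungs are in
`…StrainCubeLambSplitDepletion`. WHAT THIS IS NOT: kinematics of one slice; no statement about solutions. [folklore]
-/

noncomputable section

open Set Function Filter Topology MeasureTheory Finset
open scoped RealInnerProductSpace ENNReal NNReal Laplacian ContDiff
open Literature.Analysis.FluidPDE

namespace Summit.NavierStokesRegularity.NavierStokesRegularity.Theorems.DepletionLadder.StrainCube

-- the problem directory repeats the summit name (`NavierStokesRegularity/NavierStokesRegularity`)
set_option linter.dupNamespace false

open Summit.NavierStokesRegularity.NavierStokesRegularity.Theorems.RungReynoldsOne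
open Summit.NavierStokesRegularity.NavierStokesRegularity.Theorems.RungReynoldsOne.WeightedSlice
open Summit.NavierStokesRegularity.NavierStokesRegularity.Theorems.DepletionLadder

variable {v : EuclideanSpace ℝ (Fin 3) → EuclideanSpace ℝ (Fin 3)}
  {s : Fin 3 → Fin 3 → EuclideanSpace ℝ (Fin 3) → ℝ} {N : EuclideanSpace ℝ (Fin 3) → ℝ}

/-! ## The split chain at a fixed weight -/

/-- **The split chain at a fixed admissible weight `N`.** For a `C^∞` divergence-free `v` with `|v| ≤ M`,
`‖Dv‖ ≤ B`, `D¹v, D²v ∈ L²`, its strain `s`, a smooth weight with `0 ≤ N ≤ √q`, `N ≤ 3‖D¹v‖`,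
`|∂ₗN| ≤ 6‖D²v‖`, `Σₗ(∂ₗN)² ≤ Σₗᵢⱼ(∂ₗsᵢⱼ)²`, and `0 ≤ λ ≤ 1`:
`(1−λ)|∫⟪curl v, Dv curl v⟫| + λ(2√6/9)∫qN ≤
  M( √(∫‖curl curl v‖²) √((1−λ)²∫‖curl v‖² + (λ√6/9)²∫q) + λ(2√6/9)√(2/3) √(∫q) √(∫Σ(∂ₗsᵢⱼ)²) )`.
[folklore] -/
theorem lamb_split_weight_le (hv : ContDiff ℝ ∞ v) (hdiv : VectorCalculus.IsDivFree v)
    {M B : ℝ} (hM : ∀ x, ‖v x‖ ≤ M) (hB : ∀ x, ‖fderiv ℝ v x‖ ≤ B)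
    (h1 : ∫⁻ x, ‖iteratedFDeriv ℝ 1 v x‖ₑ ^ 2 < ⊤) (h2 : ∫⁻ x, ‖iteratedFDeriv ℝ 2 v x‖ₑ ^ 2 < ⊤)
    (hs : ∀ i j y, s i j y = (pderiv j (fun z => v z i) y + pderiv i (fun z => v z j) y) / 2)
    (hNC : ContDiff ℝ ∞ N) (hN0 : ∀ x, 0 ≤ N x)
    (hNq : ∀ x, N x ≤ Real.sqrt (∑ i, ∑ j, s i j x ^ 2))
    (hNle : ∀ x, N x ≤ 3 * ‖iteratedFDeriv ℝ 1 v x‖)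
    (hdN : ∀ l x, |pderiv l N x| ≤ 6 * ‖iteratedFDeriv ℝ 2 v x‖)
    (hdND : ∀ x, ∑ l, pderiv l N x ^ 2 ≤ ∑ l, ∑ i, ∑ j, pderiv l (s i j) x ^ 2)
    {lam : ℝ} (hlam0 : 0 ≤ lam) (hlam1 : lam ≤ 1) :
    (1 - lam) * |∫ x, ⟪curl v x, fderiv ℝ v x (curl v x)⟫| +
        lam * ((2 / 9) * Real.sqrt 6) * ∫ x, (∑ i, ∑ j, s i j x ^ 2) * N x ≤
      M * (Real.sqrt (∫ x, ‖curl (curl v) x‖ ^ 2) *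
          Real.sqrt ((1 - lam) ^ 2 * (∫ x, ‖curl v x‖ ^ 2) +
            (lam * (Real.sqrt 6 / 9)) ^ 2 * ∫ x, ∑ i, ∑ j, s i j x ^ 2) +
        lam * ((2 / 9) * Real.sqrt 6) * (Real.sqrt (2 / 3) *
          (Real.sqrt (∫ x, ∑ i, ∑ j, s i j x ^ 2) *
            Real.sqrt (∫ x, ∑ l, ∑ i, ∑ j, pderiv l (s i j) x ^ 2)))) := by
  have hM0 : 0 ≤ M := (norm_nonneg _).trans (hM 0)
  have hsC := contDiff_sym hv hs
  have hNd : Differentiable ℝ N := hNC.differentiable (by simp)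
  have cN : Continuous N := hNC.continuous
  have hv2 : ContDiff ℝ 2 v := hv.of_le (by norm_cast)
  have hv1 : ContDiff ℝ 1 v := hv.of_le (by norm_cast)
  -- vorticity, its curl, integrability of the Lamb pairing
  have hω1 : ContDiff ℝ 1 (curl v) := by
    rw [curl_eq_curlCLM_comp]
    exact curlCLM.contDiff.comp (hv2.fderiv_right (m := 1) (by norm_cast))
  have cω : Continuous (curl v) := hω1.continuous
  have cc : Continuous (curl (curl v)) := by
    have : curl (curl v) = fun x => -(Δ v) x := funext fun x => curl_curl_eq_neg_laplacian hv2 hdiv x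
    rw [this]; exact (continuous_laplacian_of hv).neg
  have T1eq : ∀ x, ‖fderiv ℝ v x‖ = ‖iteratedFDeriv ℝ 1 v x‖ := fun x => norm_fderiv_eq_norm_iteratedFDeriv_one x
  have ω_le : ∀ x, ‖curl v x‖ ≤ ‖curlCLM‖ * ‖iteratedFDeriv ℝ 1 v x‖ := fun x => by
    rw [← T1eq]; exact norm_curl_le v x
  have c_le : ∀ x, ‖curl (curl v) x‖ ≤ 6 * ‖iteratedFDeriv ℝ 2 v x‖ := fun x => by
    rw [curl_curl_eq_neg_laplacian hv2 hdiv x, norm_neg]; exact norm_laplacian_le hv x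
  have l2ω : ∫⁻ x, ‖curl v x‖ₑ ^ 2 < ⊤ := by
    refine lintegral_enorm_sq_lt_top_of_norm_le_const_mul ‖curlCLM‖ (fun x => ?_) h1
    rw [← norm_iteratedFDeriv_fderiv, norm_iteratedFDeriv_zero]
    exact norm_curl_le v x
  have iZ : Integrable (fun x => ‖curl v x‖ ^ 2) volume := integrable_sq_norm_of_lintegral_lt_top cω l2ω
  have iA : Integrable (fun x => frobeniusNormSq (fderiv ℝ (curl v) x)) volume := by
    refine integrable_of_continuous_of_nonneg (continuous_frobeniusNormSq_fderiv hω1 one_ne_zero)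
      (fun x => frobeniusNormSq_nonneg _) ?_
    exact (lintegral_ofReal_frobeniusNormSq_fderiv_curl_le hv2).trans_lt
      (ENNReal.mul_lt_top (ENNReal.mul_lt_top (by norm_num) ENNReal.ofReal_lt_top) h2)
  have iJ : Integrable (fun x => ⟪curl v x, fderiv ℝ v x (curl v x)⟫) volume := by
    refine integrable_of_norm_le_const_mul_mul B
      (cω.inner ((hv1.continuous_fderiv one_ne_zero).clm_apply cω)) cω cω l2ω l2ω fun x => ?_
    calc ‖⟪curl v x, fderiv ℝ v x (curl v x)⟫‖ ≤ ‖curl v x‖ * ‖fderiv ℝ v x (curl v x)‖ :=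
          norm_inner_le_norm _ _
      _ ≤ ‖curl v x‖ * (B * ‖curl v x‖) :=
          mul_le_mul_of_nonneg_left ((fderiv ℝ v x).le_of_opNorm_le (hB x) _) (norm_nonneg _)
      _ = B * ‖curl v x‖ * ‖curl v x‖ := by ring
  have hLamb := integral_stretching_eq_integral_inner_cross hv2 hdiv hM iZ iA iJ
  have iL : Integrable (fun x => ⟪v x, cross (curl v x) (curl (curl v) x)⟫) volume :=
    integrable_inner_cross_curl hv2 hM iZ iA
  -- the chain side: the IBP identity and the pointwise bound
  have P := integrable_ibp_products hv hM hB h1 h2 hs hNC hN0 hNle hdN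
  set q : EuclideanSpace ℝ (Fin 3) → ℝ := fun x => ∑ i, ∑ j, s i j x ^ 2 with hq
  set Dg : EuclideanSpace ℝ (Fin 3) → ℝ := fun x => ∑ l, ∑ i, ∑ j, pderiv l (s i j) x ^ 2 with hDg
  have cq : Continuous q := continuous_finsetSum _ fun i _ => continuous_finsetSum _ fun j _ =>
    ((hsC i j).continuous).pow 2
  have cDg : Continuous Dg := continuous_finsetSum _ fun l _ => continuous_finsetSum _ fun i _ =>
    continuous_finsetSum _ fun j _ => ((contDiff_pderiv (hsC i j) l).continuous).pow 2
  have hq0 : ∀ x, 0 ≤ q x := fun x => sumSq_nonneg (s := s) x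
  have hDg0 : ∀ x, 0 ≤ Dg x := fun x =>
    sum_nonneg fun l _ => sumSq_nonneg (s := fun i j y => pderiv l (s i j) y) x
  have iq : Integrable q := by
    refine integrable_of_le_iteratedFDeriv_mul hv h1 h1 cq 9 fun x => ?_
    rw [abs_of_nonneg (hq0 x)]
    nlinarith [sumSq_sym_le hv hs x]
  have iDg : Integrable Dg := by
    refine integrable_of_le_iteratedFDeriv_mul hv h2 h2 cDg 27 fun x => ?_
    rw [abs_of_nonneg (hDg0 x)]
    nlinarith [gradSq_sym_le hv hs x]
  -- the weight `g = (1−λ)²‖ω‖² + (λ√6 N/9)²` of the joint bound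
  set β : ℝ := lam * (Real.sqrt 6 / 9) with hβ
  have hβ0 : 0 ≤ β := by positivity
  have hβ1 : β ≤ 1 := by
    have h6 : Real.sqrt 6 ≤ 3 := by
      rw [show (3:ℝ) = Real.sqrt (3 ^ 2) by rw [Real.sqrt_sq (by norm_num)]]
      exact Real.sqrt_le_sqrt (by norm_num)
    rw [hβ]; nlinarith [Real.sqrt_nonneg 6]
  set g : EuclideanSpace ℝ (Fin 3) → ℝ := fun x => (1 - lam) ^ 2 * ‖curl v x‖ ^ 2 + (β * N x) ^ 2 with hg
  have hg0 : ∀ x, 0 ≤ g x := fun x => by positivity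
  have cg : Continuous g := ((cω.norm.pow 2).const_mul _).add ((cN.const_mul _).pow 2)
  have g_le : ∀ x, g x ≤ (‖curlCLM‖ ^ 2 + 9) * ‖iteratedFDeriv ℝ 1 v x‖ ^ 2 := by
    intro x
    have h1' : (1 - lam) ^ 2 * ‖curl v x‖ ^ 2 ≤ ‖curlCLM‖ ^ 2 * ‖iteratedFDeriv ℝ 1 v x‖ ^ 2 := by
      have a : (1 - lam) ^ 2 ≤ 1 := by nlinarith
      have b : ‖curl v x‖ ^ 2 ≤ (‖curlCLM‖ * ‖iteratedFDeriv ℝ 1 v x‖) ^ 2 :=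
        pow_le_pow_left₀ (norm_nonneg _) (ω_le x) 2
      nlinarith [sq_nonneg ‖curl v x‖]
    have h2' : (β * N x) ^ 2 ≤ 9 * ‖iteratedFDeriv ℝ 1 v x‖ ^ 2 := by
      have b : β * N x ≤ 1 * (3 * ‖iteratedFDeriv ℝ 1 v x‖) :=
        mul_le_mul hβ1 (hNle x) (hN0 x) zero_le_one
      have b0 : 0 ≤ β * N x := mul_nonneg hβ0 (hN0 x)
      nlinarith
    rw [hg]; simp only; nlinarith
  have ig : Integrable g := by
    refine integrable_of_le_iteratedFDeriv_mul hv h1 h1 cg (‖curlCLM‖ ^ 2 + 9) fun x => ?_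
    rw [abs_of_nonneg (hg0 x)]
    nlinarith [g_le x]
  have sqrt_g_le : ∀ x, Real.sqrt (g x) ≤ (‖curlCLM‖ + 3) * ‖iteratedFDeriv ℝ 1 v x‖ := by
    intro x
    refine Real.sqrt_le_iff.2 ⟨by positivity, ?_⟩
    nlinarith [g_le x, norm_nonneg curlCLM, norm_nonneg (iteratedFDeriv ℝ 1 v x),
      mul_nonneg (norm_nonneg curlCLM) (norm_nonneg (iteratedFDeriv ℝ 1 v x))]
  have icg : Integrable (fun x => ‖curl (curl v) x‖ * Real.sqrt (g x)) := by
    refine integrable_of_le_iteratedFDeriv_mul hv h2 h1 (cc.norm.mul (Real.continuous_sqrt.comp cg))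
      (6 * (‖curlCLM‖ + 3)) fun x => ?_
    rw [abs_mul, abs_of_nonneg (norm_nonneg _), abs_of_nonneg (Real.sqrt_nonneg _)]
    calc ‖curl (curl v) x‖ * Real.sqrt (g x)
        ≤ (6 * ‖iteratedFDeriv ℝ 2 v x‖) * ((‖curlCLM‖ + 3) * ‖iteratedFDeriv ℝ 1 v x‖) :=
          mul_le_mul (c_le x) (sqrt_g_le x) (Real.sqrt_nonneg _) (by positivity)
      _ = 6 * (‖curlCLM‖ + 3) * ‖iteratedFDeriv ℝ 2 v x‖ * ‖iteratedFDeriv ℝ 1 v x‖ := by ring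
  have ic2 : Integrable (fun x => ‖curl (curl v) x‖ ^ 2) := by
    refine integrable_of_le_iteratedFDeriv_mul hv h2 h2 (cc.norm.pow 2) 36 fun x => ?_
    rw [abs_of_nonneg (sq_nonneg _)]
    nlinarith [c_le x, norm_nonneg (curl (curl v) x)]
  have iqD : Integrable fun x => Real.sqrt (q x) * Real.sqrt (Dg x) := by
    refine integrable_of_le_iteratedFDeriv_mul hv h1 h2 ((Real.continuous_sqrt.comp cq).mul
      (Real.continuous_sqrt.comp cDg)) 18 fun x => ?_
    rw [abs_mul, abs_of_nonneg (Real.sqrt_nonneg _), abs_of_nonneg (Real.sqrt_nonneg _)]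
    nlinarith [mul_le_mul (sqrt_sumSq_sym_le hv hs x) (sqrt_gradSq_sym_le hv hs x) (Real.sqrt_nonneg _)
      (by positivity : (0:ℝ) ≤ 3 * ‖iteratedFDeriv ℝ 1 v x‖)]
  -- the pointwise bound, integrated
  have iS : Integrable fun x => ∑ i, ∑ j, pderiv j (fun y => s i j y * N y) x * v x i :=
    integrable_finsetSum _ fun i _ => integrable_finsetSum _ fun j _ => (P i j).1
  have hpt : ∀ x, (1 - lam) * |⟪v x, cross (curl v x) (curl (curl v) x)⟫| +
      lam * ((2 / 9) * Real.sqrt 6) * -(∑ i, ∑ j, pderiv j (fun y => s i j y * N y) x * v x i) ≤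
      M * (‖curl (curl v) x‖ * Real.sqrt (g x) +
        lam * ((2 / 9) * Real.sqrt 6) * (Real.sqrt (2 / 3) * (Real.sqrt (q x) * Real.sqrt (Dg x)))) :=
    fun x => lamb_split_pointwise hv hdiv hs hNd hlam0 x (hM x) (hN0 x) (hdND x)
  have iSn : Integrable fun x => -(∑ i, ∑ j, pderiv j (fun y => s i j y * N y) x * v x i) := iS.neg
  have iL1 : Integrable fun x => (1 - lam) * |⟪v x, cross (curl v x) (curl (curl v) x)⟫| :=
    iL.abs.const_mul _
  have iS1 : Integrable fun x =>
      lam * ((2 / 9) * Real.sqrt 6) * -(∑ i, ∑ j, pderiv j (fun y => s i j y * N y) x * v x i) :=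
    iSn.const_mul _
  have iLHS : Integrable fun x => (1 - lam) * |⟪v x, cross (curl v x) (curl (curl v) x)⟫| +
      lam * ((2 / 9) * Real.sqrt 6) * -(∑ i, ∑ j, pderiv j (fun y => s i j y * N y) x * v x i) :=
    iL1.add iS1
  have iRHS : Integrable fun x => M * (‖curl (curl v) x‖ * Real.sqrt (g x) +
      lam * ((2 / 9) * Real.sqrt 6) * (Real.sqrt (2 / 3) * (Real.sqrt (q x) * Real.sqrt (Dg x)))) :=
    (icg.add ((iqD.const_mul _).const_mul _)).const_mul M
  have step1 := integral_mono iLHS iRHS hpt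
  rw [integral_add iL1 iS1, integral_const_mul, integral_const_mul,
    integral_neg, integral_const_mul, integral_add icg ((iqD.const_mul _).const_mul _),
    integral_const_mul, integral_const_mul] at step1
  -- left side: Lamb pairing and the IBP identity
  have hJ : |∫ x, ⟪curl v x, fderiv ℝ v x (curl v x)⟫| ≤
      ∫ x, |⟪v x, cross (curl v x) (curl (curl v) x)⟫| := by
    rw [hLamb]; exact abs_integral_le_integral_abs
  have hIBP : ∫ x, q x * N x = -∫ x, ∑ i, ∑ j, pderiv j (fun y => s i j y * N y) x * v x i :=
    integral_sumSq_mul_weight_eq hv hM hB h1 h2 hs hNC hN0 hNle hdN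
  -- right side: Cauchy–Schwarz twice
  have isg2 : Integrable fun x => Real.sqrt (g x) ^ 2 :=
    ig.congr (Eventually.of_forall fun x => (Real.sq_sqrt (hg0 x)).symm)
  have cs1 : ∫ x, ‖curl (curl v) x‖ * Real.sqrt (g x) ≤
      Real.sqrt (∫ x, ‖curl (curl v) x‖ ^ 2) * Real.sqrt (∫ x, g x) := by
    have h := integral_mul_le_sqrt_mul_sqrt (μ := volume) (fun x => norm_nonneg (curl (curl v) x))
      (fun x => Real.sqrt_nonneg (g x)) cc.norm.aestronglyMeasurable
      (Real.continuous_sqrt.comp cg).aestronglyMeasurable ic2 isg2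
    have e2 : ∫ x, Real.sqrt (g x) ^ 2 = ∫ x, g x :=
      integral_congr_ae (Eventually.of_forall fun x => Real.sq_sqrt (hg0 x))
    rw [e2] at h
    exact h
  have isq2 : Integrable fun x => Real.sqrt (q x) ^ 2 :=
    iq.congr (Eventually.of_forall fun x => (Real.sq_sqrt (hq0 x)).symm)
  have isD2 : Integrable fun x => Real.sqrt (Dg x) ^ 2 :=
    iDg.congr (Eventually.of_forall fun x => (Real.sq_sqrt (hDg0 x)).symm)
  have cs2 : ∫ x, Real.sqrt (q x) * Real.sqrt (Dg x) ≤ Real.sqrt (∫ x, q x) * Real.sqrt (∫ x, Dg x) := by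
    have h := integral_mul_le_sqrt_mul_sqrt (μ := volume) (fun x => Real.sqrt_nonneg (q x))
      (fun x => Real.sqrt_nonneg (Dg x)) (Real.continuous_sqrt.comp cq).aestronglyMeasurable
      (Real.continuous_sqrt.comp cDg).aestronglyMeasurable isq2 isD2
    have e1 : ∫ x, Real.sqrt (q x) ^ 2 = ∫ x, q x :=
      integral_congr_ae (Eventually.of_forall fun x => Real.sq_sqrt (hq0 x))
    have e2 : ∫ x, Real.sqrt (Dg x) ^ 2 = ∫ x, Dg x :=
      integral_congr_ae (Eventually.of_forall fun x => Real.sq_sqrt (hDg0 x))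
    rw [e1, e2] at h
    exact h
  -- `∫ g ≤ (1−λ)² Z + β² ∫q`
  have N2_le : ∀ x, N x ^ 2 ≤ q x := fun x => by
    calc N x ^ 2 ≤ Real.sqrt (q x) ^ 2 := pow_le_pow_left₀ (hN0 x) (hNq x) 2
      _ = q x := Real.sq_sqrt (hq0 x)
  have iN2 : Integrable fun x => N x ^ 2 := by
    refine iq.mono' (cN.pow 2).aestronglyMeasurable (Eventually.of_forall fun x => ?_)
    rw [Real.norm_of_nonneg (sq_nonneg _)]
    exact N2_le x
  have hg_int : ∫ x, g x ≤ (1 - lam) ^ 2 * (∫ x, ‖curl v x‖ ^ 2) + β ^ 2 * ∫ x, q x := by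
    have e : ∫ x, g x = (1 - lam) ^ 2 * (∫ x, ‖curl v x‖ ^ 2) + β ^ 2 * ∫ x, N x ^ 2 := by
      rw [hg]; simp only
      rw [integral_add (iZ.const_mul _) ((iN2.const_mul (β ^ 2)).congr
        (Eventually.of_forall fun x => by simp only; ring)), integral_const_mul]
      congr 1
      rw [show (fun x => (β * N x) ^ 2) = fun x => β ^ 2 * N x ^ 2 from funext fun x => by ring,
        integral_const_mul]
    rw [e]
    have := integral_mono iN2 iq N2_le
    nlinarith [sq_nonneg β]
  have hsg : Real.sqrt (∫ x, g x) ≤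
      Real.sqrt ((1 - lam) ^ 2 * (∫ x, ‖curl v x‖ ^ 2) + β ^ 2 * ∫ x, q x) := Real.sqrt_le_sqrt hg_int
  have hc0 : 0 ≤ Real.sqrt (∫ x, ‖curl (curl v) x‖ ^ 2) := Real.sqrt_nonneg _
  have hlamc : 0 ≤ lam * ((2 / 9) * Real.sqrt 6) := by positivity
  have h23 : 0 ≤ Real.sqrt (2 / 3) := Real.sqrt_nonneg _
  calc (1 - lam) * |∫ x, ⟪curl v x, fderiv ℝ v x (curl v x)⟫| +
        lam * ((2 / 9) * Real.sqrt 6) * ∫ x, q x * N x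
      ≤ ((1 - lam) * ∫ x, |⟪v x, cross (curl v x) (curl (curl v) x)⟫|) +
          lam * ((2 / 9) * Real.sqrt 6) * -(∫ x, ∑ i, ∑ j, pderiv j (fun y => s i j y * N y) x * v x i) := by
        rw [hIBP]
        exact add_le_add (mul_le_mul_of_nonneg_left hJ (sub_nonneg.2 hlam1)) le_rfl
    _ ≤ M * ((∫ x, ‖curl (curl v) x‖ * Real.sqrt (g x)) +
          lam * ((2 / 9) * Real.sqrt 6) * (Real.sqrt (2 / 3) *
            ∫ x, Real.sqrt (q x) * Real.sqrt (Dg x))) := step1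
    _ ≤ M * (Real.sqrt (∫ x, ‖curl (curl v) x‖ ^ 2) *
          Real.sqrt ((1 - lam) ^ 2 * (∫ x, ‖curl v x‖ ^ 2) + β ^ 2 * ∫ x, q x) +
        lam * ((2 / 9) * Real.sqrt 6) * (Real.sqrt (2 / 3) *
          (Real.sqrt (∫ x, q x) * Real.sqrt (∫ x, Dg x)))) := by
        refine mul_le_mul_of_nonneg_left (add_le_add ?_ ?_) hM0
        · exact cs1.trans (mul_le_mul_of_nonneg_left hsg hc0)
        · exact mul_le_mul_of_nonneg_left (mul_le_mul_of_nonneg_left cs2 h23) hlamc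

end Summit.NavierStokesRegularity.NavierStokesRegularity.Theorems.DepletionLadder.StrainCube

end
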